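import Summits.AtomisticToContinuum.Crystallization.Theorems.FrustratedLawDichotomyStrainedPatchHomEntryLeafHTA2QParts
import Summits.AtomisticToContinuum.Crystallization.Theorems.FrustratedLawDichotomyStrainedPatchHomEntryLeafHTA2QCentredRot
import Summits.AtomisticToContinuum.Crystallization.Theorems.FrustratedLawDichotomyStrainedPatchHomEntryLeafHTA2QCellXA2

/-!
# ★★★ K1-v2 END TO END at the `0.95 t_b` crossover cell: `entryLeafOKHT4A2QQDCR muRec qX95c pXA2 QXA GnXA JX95 leaf cX95 wX = true`
# (27623 `(H) HomFloor (1/625)`, hcp half; hand-1 g34 FINDING §3b)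

decomp-a2c hand-1 g34.  KERNEL: `treeA2Q_XA` — ONE inner hull leaf of the centred rotated verdict closes the sheet-tracked confined box of the SECOND-ORDER certificate
(radii `(1.341, 1.645, 0.525)e-3` + hull slop `(0.32, 0.37, 0.02)e-3`; ≈ 111 s); ★★★ `entryLeafOKHT4A2QQDCR_XA2` (assembly with `…CellXA2.htCertSideA2Q_XA2`), whence by
`…HTA2QCentredRot.entryLeafOKHT4A2QQDCR_sound` the hver conclusion holds on the whole cell — with the slab constant at its `σ₁` floor (`t = 0.01102`).

Kernel fact + assembly; 0 sorry; standard axioms.  `--supports stmt-AtomisticToContinuum-27623`.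
-/

namespace Summit.AtomisticToContinuum.Crystallization.Theorems.FrustratedLawDichotomyStrainedPatchHomEntryLeafHT

open Literature.Analysis.ValidatedNumerics.Numerics
open Summit.AtomisticToContinuum.Crystallization.Theorems.FrustratedLawDichotomyStrainedPatchHomCertTree (CertTree treeOK)
open Summit.AtomisticToContinuum.Crystallization.Theorems.FrustratedLawDichotomyStrainedPatchHomEntryTable (muRec)
open Summit.AtomisticToContinuum.Crystallization.Theorems.FrustratedLawDichotomyStrainedPatchHomEntryFitHcpCentred (entryLeafOKHQDCR)
open Summit.AtomisticToContinuum.Crystallization.Theorems.FrustratedLawDichotomyStrainedPatchHomSlopeLJ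
open Summit.AtomisticToContinuum.Crystallization.Theorems.FrustratedLawDichotomyStrainedPatchHomSlopeLJAffine
open Summit.AtomisticToContinuum.Crystallization.Theorems.FrustratedLawDichotomyStrainedPatchHomSlopeLJAffine2Kit

set_option maxRecDepth 100000 in
set_option maxHeartbeats 4000000 in
/-- ★ KERNEL: ONE inner hull leaf closes the second-order confined box at `cX95 × wX` (`≈ 111 s`). -/
theorem treeA2Q_XA : treeOK (hullInner (entryLeafOKHQDCR muRec qX95c) JX95 cX95) CertTree.leaf cX95 (htWr pXA2 cX95 wX) = true := by
  decide +kernel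

/-- ★★★ **THE `0.95 t_b` CROSSOVER CELL CLOSES END TO END THROUGH THE SECOND-ORDER AFFINE LEAF.** [assembly] -/
theorem entryLeafOKHT4A2QQDCR_XA2 : entryLeafOKHT4A2QQDCR muRec qX95c pXA2 QXA GnXA JX95 CertTree.leaf cX95 wX = true := by
  have h1 := htCertSideA2Q_XA2
  have h2 := treeA2Q_XA
  unfold entryLeafOKHT4A2QQDCR entryLeafOKHT4A2Q
  rw [h1, h2]
  rfl

end Summit.AtomisticToContinuum.Crystallization.Theorems.FrustratedLawDichotomyStrainedPatchHomEntryLeafHT
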